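import Summits.AtomisticToContinuum.HydrodynamicLimit.Theorems.LambertianContactSwapLambertianWellPosedRegular
import Literature.MathematicalPhysics.KineticTheory.LambertianHardSphereFlow
import Literature.MathematicalPhysics.KineticTheory.HardSphereEuler
import Mathlib.Analysis.SpecificLimits.Basic
import HarnessLib

/-!
# Korolyuk's upper bound for the Lambertian collision count
# (`LambertianContactSwap.LambertianEuler`, stmt-AtomisticToContinuum-11854, line `Sketch`;
# sub-goal `lintegral_lambertCount_le_liminf` of the `N`-uniform equilibrium collision rate)

Abstract-probability step (Korolyuk / Fatou) of the `N`-uniform equilibrium collision rate of the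
Lambertian gas.  For the Lambertian hard-sphere recursion of
`Literature.MathematicalPhysics.KineticTheory.LambertianHardSphereFlow` write `t_k = lambertInstant`,
`K_s = lambertCount` (number of instants in `[0, s]`), `τ_k = freeExitTime (lambertStateAfter … k)`
(`t_{k+1} = t_k + τ_k`).  On a path whose instants are SIMPLE (`τ_k > 0` for all `k`) and do NOT
ACCUMULATE (every horizon is passed by some instant), for `h > 0` and the mesh `h' = h/(n+1)` of
`(0, h]`:

* `eventually_lambertCount_le_sum` (pathwise): for all large `n`, at least `K_h` of the mesh intervals
  `(j h', (j+1) h']`, `j ≤ n`, carry an increment `K_{(j+1)h'} ≥ 1 + K_{jh'}`.  Indeed once `h'` is below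
  the minimal gap `min_{k<K_h} τ_k` (a finite minimum of positive reals), the `K_h` instants
  `0 < t_1 < ⋯ < t_{K_h} ≤ h` lie in pairwise distinct mesh intervals (`j_k = ⌈t_k/h'⌉ - 1 ≤ n`), and the
  interval of `t_k` is counted: `K_{j_k h'} < k ≤ K_{(j_k+1) h'}` by the two segment characterisations
  `le_lambertCount_of_lambertInstant_le` / `lambertCount_lt_of_lt_lambertInstant`
  (`LRestart.exists_lambert_segment` + `lambertCount_eq_of_segment`); sum over the image of the
  injection `k ↦ j_k` (`Finset.sum_image`, `Finset.sum_le_sum_of_subset`).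
* `lintegral_lambertCount_le_liminf` (the sub-goal): for a finite law `μ` of (configuration, noise)
  under which almost every path is simple and non-accumulating,
  `∫⁻ K_h dμ ≤ liminf_n Σ_{j ≤ n} μ {1 + K_{jh'} ≤ K_{(j+1)h'}}`: the right-hand sum is
  `∫⁻ S_n dμ`, `S_n = Σ_j 1{1 + K_{jh'} ≤ K_{(j+1)h'}}` (`lintegral_finsetSum`, `lintegral_indicator_one`,
  measurability from `measurable_lambertCount`), `K_h ≤ liminf_n S_n` a.e. by the pathwise step, and
  Fatou (`lintegral_liminf_le`).

References: Daley–Vere-Jones, *An Introduction to the Theory of Point Processes* I, Prop. 3.3.I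
(Korolyuk's theorem) and §3.3 (Khinchin's existence theorem, Fatou step).  All statements [folklore].
-/

noncomputable section

open scoped BigOperators Topology ENNReal
open MeasureTheory Filter Set
open Literature.MathematicalPhysics.KineticTheory
open Literature.Analysis.FluidPDE Literature.Analysis.FluidPDE.Alexander

namespace Summit.AtomisticToContinuum.HydrodynamicLimit.Theorems.LambertianContactSwapLambertianEulerKorolyuk

/-! ## Pathwise: segment characterisations of the count and Korolyuk's counting inequality -/

section Pathwise

variable {d : Type*} [Fintype d] {X : Type*} {N : ℕ} {G : Geometry d X} {ε : ℝ}
  {ξs : ℕ → EuclideanSpace ℝ d} {z : Config N d X}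

/-- If the instants pass beyond `s` and `t_k ≤ s`, then at least `k` collisions are counted in `[0, s]`
(the count is the index of the segment containing `s`). [folklore] -/
theorem le_lambertCount_of_lambertInstant_le {s : ℝ} {k : ℕ}
    (hacc : ∃ m, ENNReal.ofReal s < lambertInstant G ε ξs z m)
    (hk : lambertInstant G ε ξs z k ≤ ENNReal.ofReal s) : k ≤ lambertCount G ε ξs z s := by
  obtain ⟨m, h1, h2⟩ := LRestart.exists_lambert_segment hacc le_rfl
  rw [lambertCount_eq_of_segment h1 h2]
  by_contra hlt
  exact (not_le.2 h2) ((monotone_lambertInstant ξs z (by omega)).trans hk)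

/-- If `s < t_k` then fewer than `k` collisions are counted in `[0, s]`. [folklore] -/
theorem lambertCount_lt_of_lt_lambertInstant {s : ℝ} {k : ℕ}
    (hk : ENNReal.ofReal s < lambertInstant G ε ξs z k) : lambertCount G ε ξs z s < k := by
  obtain ⟨m, h1, h2⟩ := LRestart.exists_lambert_segment ⟨k, hk⟩ le_rfl
  rw [lambertCount_eq_of_segment h1 h2]
  by_contra hle
  exact (not_le.2 hk) ((monotone_lambertInstant ξs z (not_lt.1 hle)).trans h1)

/-- **Korolyuk's counting inequality, pathwise.**  On a simple (`τ_k > 0` for all `k`) and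
non-accumulating path, for `h > 0` and all large `n`: any `f : ℕ → ℝ≥0∞` that is `≥ 1` on the indices
`j` of the mesh intervals `(j h', (j+1) h']`, `h' = h/(n+1)`, carrying an increment
`1 + K_{jh'} ≤ K_{(j+1)h'}` has `Σ_{j ≤ n} f j ≥ K_h` (the `K_h` instants in `(0, h]` lie in pairwise
distinct, counted mesh intervals once `h'` is below the minimal gap). [folklore] -/
theorem eventually_lambertCount_le_sum
    (hpos : ∀ k, 0 < freeExitTime G ε (lambertStateAfter G ε ξs z k))
    (hacc : ∀ T : ℝ, ∃ k, ENNReal.ofReal T < lambertInstant G ε ξs z k) {h : ℝ} (hh : 0 < h) :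
    ∀ᶠ n : ℕ in atTop, ∀ f : ℕ → ℝ≥0∞,
      (∀ j : ℕ, 1 + lambertCount G ε ξs z ((j : ℝ) * (h / ((n : ℝ) + 1))) ≤
          lambertCount G ε ξs z (((j : ℝ) + 1) * (h / ((n : ℝ) + 1))) → 1 ≤ f j) →
        (lambertCount G ε ξs z h : ℝ≥0∞) ≤ ∑ j ∈ Finset.range (n + 1), f j := by
  set K := lambertCount G ε ξs z h with hK
  set t : ℕ → ℝ≥0∞ := lambertInstant G ε ξs z with ht
  set τ : ℕ → ℝ≥0∞ := fun k => freeExitTime G ε (lambertStateAfter G ε ξs z k) with hτ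
  rcases Nat.eq_zero_or_pos K with hK0 | hKpos
  · exact Eventually.of_forall fun n f _ => by rw [hK0, Nat.cast_zero]; exact zero_le
  -- the segment of `h`: `t_K ≤ h`, so the first `K + 1` instants and the first `K` gaps are finite
  obtain ⟨m, hm1, hm2⟩ := LRestart.exists_lambert_segment (hacc h) le_rfl
  have hKm : K = m := lambertCount_eq_of_segment hm1 hm2
  have htK : t K ≤ ENNReal.ofReal h := by rw [hKm]; exact hm1
  have htop : ∀ k ≤ K, t k ≠ ∞ := fun k hk =>
    ne_top_of_le_ne_top ENNReal.ofReal_ne_top ((monotone_lambertInstant ξs z hk).trans htK)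
  have hsucc : ∀ k, t (k + 1) = t k + τ k := fun k => lambertInstant_succ ξs z k
  have hτtop : ∀ k < K, τ k ≠ ∞ := fun k hk => by
    have h1 := htop (k + 1) hk
    rw [hsucc] at h1
    exact (ENNReal.add_ne_top.1 h1).2
  have hgap : ∀ k < K, (t (k + 1)).toReal = (t k).toReal + (τ k).toReal := fun k hk => by
    rw [hsucc, ENNReal.toReal_add (htop k hk.le) (hτtop k hk)]
  -- the minimal gap `g > 0`
  obtain ⟨k₀, hk₀, hmin⟩ := (Finset.range K).exists_min_image (fun k => (τ k).toReal)
    ⟨0, Finset.mem_range.2 hKpos⟩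
  have hk₀K : k₀ < K := Finset.mem_range.1 hk₀
  set g := (τ k₀).toReal with hg
  have hgpos : 0 < g := ENNReal.toReal_pos (hpos k₀).ne' (hτtop k₀ hk₀K)
  have hming : ∀ k < K, g ≤ (τ k).toReal := fun k hk => hmin k (Finset.mem_range.2 hk)
  -- the instants `t_1, …, t_K` as reals: in `(0, h]`, separated by at least `g`
  have htpos : ∀ k < K, 0 < (t (k + 1)).toReal := fun k hk => by
    refine ENNReal.toReal_pos (ne_of_gt ?_) (htop (k + 1) hk)
    calc (0 : ℝ≥0∞) < τ 0 := hpos 0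
      _ = t 1 := (lambertInstant_one ξs z).symm
      _ ≤ t (k + 1) := monotone_lambertInstant ξs z (by omega)
  have htle : ∀ k < K, (t (k + 1)).toReal ≤ h := fun k hk =>
    ENNReal.toReal_le_of_le_ofReal hh.le ((monotone_lambertInstant ξs z hk).trans htK)
  have hsep : ∀ k₁ k₂, k₁ < k₂ → k₂ < K → (t (k₁ + 1)).toReal + g ≤ (t (k₂ + 1)).toReal := by
    intro k₁ k₂ h12 h2K
    calc (t (k₁ + 1)).toReal + g ≤ (t (k₁ + 1)).toReal + (τ (k₁ + 1)).toReal := by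
          gcongr; exact hming (k₁ + 1) (by omega)
      _ = (t (k₁ + 1 + 1)).toReal := (hgap (k₁ + 1) (by omega)).symm
      _ ≤ (t (k₂ + 1)).toReal :=
        ENNReal.toReal_mono (htop (k₂ + 1) h2K) (monotone_lambertInstant ξs z (by omega))
  -- fine meshes: `h / (n + 1) < g` eventually
  have hev : ∀ᶠ n : ℕ in atTop, h / ((n : ℝ) + 1) < g := by
    have h1 : Tendsto (fun n : ℕ => h * (1 / ((n : ℝ) + 1))) atTop (𝓝 (h * 0)) :=
      tendsto_one_div_add_atTop_nhds_zero_nat.const_mul h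
    rw [mul_zero] at h1
    filter_upwards [h1.eventually_lt_const hgpos] with n hn
    rwa [← mul_one_div]
  filter_upwards [hev] with n hn f hf
  set h' := h / ((n : ℝ) + 1) with hh'
  have hn1 : (0 : ℝ) < (n : ℝ) + 1 := by positivity
  have hh'pos : 0 < h' := div_pos hh hn1
  have hhh' : h / h' = (n : ℝ) + 1 := by rw [hh']; field_simp
  -- the mesh interval `(J k * h', (J k + 1) * h']` of the instant `t_{k+1}`, `k < K`
  set J : ℕ → ℕ := fun k => ⌈(t (k + 1)).toReal / h'⌉₊ - 1 with hJ
  have hJ1 : ∀ k < K, J k + 1 = ⌈(t (k + 1)).toReal / h'⌉₊ := fun k hk =>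
    Nat.sub_add_cancel (Nat.ceil_pos.2 (div_pos (htpos k hk) hh'pos))
  have hJcast : ∀ k < K, (J k : ℝ) + 1 = (⌈(t (k + 1)).toReal / h'⌉₊ : ℝ) := fun k hk => by
    exact_mod_cast hJ1 k hk
  have hJlt : ∀ k < K, (J k : ℝ) * h' < (t (k + 1)).toReal := fun k hk => by
    have h1 : (⌈(t (k + 1)).toReal / h'⌉₊ : ℝ) < (t (k + 1)).toReal / h' + 1 :=
      Nat.ceil_lt_add_one (div_pos (htpos k hk) hh'pos).le
    rw [← hJcast k hk] at h1
    exact (lt_div_iff₀ hh'pos).1 (by linarith)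
  have hJle : ∀ k < K, (t (k + 1)).toReal ≤ ((J k : ℝ) + 1) * h' := fun k hk => by
    rw [hJcast k hk]
    exact (div_le_iff₀ hh'pos).1 (Nat.le_ceil _)
  have hJn : ∀ k < K, J k ∈ Finset.range (n + 1) := fun k hk => by
    have h1 : ⌈(t (k + 1)).toReal / h'⌉₊ ≤ n + 1 := by
      refine Nat.ceil_le.2 ?_
      calc (t (k + 1)).toReal / h' ≤ h / h' := by gcongr; exact htle k hk
        _ = ((n + 1 : ℕ) : ℝ) := by rw [hhh']; push_cast; ring
    have h2 := hJ1 k hk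
    rw [Finset.mem_range]
    omega
  -- the interval of an instant is counted: `K_{J k h'} < k + 1 ≤ K_{(J k + 1) h'}`
  have hcount : ∀ k < K, 1 + lambertCount G ε ξs z ((J k : ℝ) * h') ≤
      lambertCount G ε ξs z (((J k : ℝ) + 1) * h') := fun k hk => by
    have h1 : lambertCount G ε ξs z ((J k : ℝ) * h') < k + 1 :=
      lambertCount_lt_of_lt_lambertInstant
        ((ENNReal.ofReal_lt_iff_lt_toReal (by positivity) (htop (k + 1) hk)).2 (hJlt k hk))
    have h2 : k + 1 ≤ lambertCount G ε ξs z (((J k : ℝ) + 1) * h') :=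
      le_lambertCount_of_lambertInstant_le (hacc _)
        ((ENNReal.le_ofReal_iff_toReal_le (htop (k + 1) hk) (by positivity)).2 (hJle k hk))
    omega
  -- distinct instants lie in distinct mesh intervals (`h' < g`)
  have hinj : Set.InjOn J ↑(Finset.range K) := by
    suffices H : ∀ k₁ k₂, k₁ < k₂ → k₂ < K → J k₁ ≠ J k₂ by
      intro k₁ hk₁ k₂ hk₂ hJeq
      rw [Finset.coe_range, Set.mem_Iio] at hk₁ hk₂
      rcases lt_trichotomy k₁ k₂ with hlt | heq | hgt
      · exact absurd hJeq (H k₁ k₂ hlt hk₂)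
      · exact heq
      · exact absurd hJeq.symm (H k₂ k₁ hgt hk₁)
    intro k₁ k₂ h12 h2K hJeq
    have h1 := hJlt k₁ (h12.trans h2K)
    have h2 := hJle k₂ h2K
    have h3 := hsep k₁ k₂ h12 h2K
    rw [hJeq] at h1
    rw [add_mul, one_mul] at h2
    linarith
  -- sum over the (injective) image of `k ↦ J k`
  calc (K : ℝ≥0∞) = ∑ _k ∈ Finset.range K, (1 : ℝ≥0∞) := by simp
    _ ≤ ∑ k ∈ Finset.range K, f (J k) :=
      Finset.sum_le_sum fun k hk => hf (J k) (hcount k (Finset.mem_range.1 hk))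
    _ = ∑ j ∈ (Finset.range K).image J, f j := (Finset.sum_image hinj).symm
    _ ≤ ∑ j ∈ Finset.range (n + 1), f j :=
      Finset.sum_le_sum_of_subset
        (Finset.image_subset_iff.2 fun k hk => hJn k (Finset.mem_range.1 hk))

end Pathwise

/-! ## Korolyuk's upper bound under a finite law -/

/-- **Korolyuk's upper bound for the Lambertian collision count.**  For `0 < σ < 1/2`, `N`, a finite
measure `μ` on (configuration, noise sequence) of `N + 1` hard spheres of diameter `hsDiameter σ N` on
`𝕋³` under which almost surely every post-collisional state has a positive exit time (simple instants)
and the instants do not accumulate, and `h > 0`: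
`∫⁻ K_h dμ ≤ liminf_{n → ∞} Σ_{j=0}^{n} μ {1 + K_{j h'} ≤ K_{(j+1) h'}}`, `h' = h/(n+1)` — the mean number
of collisions in `[0, h]` is at most the lim inf of the expected number of mesh intervals carrying a
collision (pathwise `K_h ≤ liminf_n S_n`, `eventually_lambertCount_le_sum`, then Fatou,
`lintegral_liminf_le`). [folklore] -/
theorem lintegral_lambertCount_le_liminf :
    ∀ {σ : ℝ}, 0 < σ → σ < 2⁻¹ → ∀ (N : ℕ) (μ : Measure (Config (N + 1) (Fin 3) T3 × (ℕ → V3))) [IsFiniteMeasure μ],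
      (∀ᵐ p ∂μ, ∀ k : ℕ, 0 < freeExitTime (Torus.geometry (Fin 3)) (hsDiameter σ N)
          (lambertStateAfter (Torus.geometry (Fin 3)) (hsDiameter σ N) p.2 p.1 k)) →
      (∀ᵐ p ∂μ, ∀ T : ℝ, ∃ k, ENNReal.ofReal T < lambertInstant (Torus.geometry (Fin 3)) (hsDiameter σ N) p.2 p.1 k) →
      ∀ h : ℝ, 0 < h →
        ∫⁻ p, (lambertCount (Torus.geometry (Fin 3)) (hsDiameter σ N) p.2 p.1 h : ℝ≥0∞) ∂μ ≤
          Filter.liminf (fun n : ℕ => ∑ j ∈ Finset.range (n + 1),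
            μ {p | 1 + lambertCount (Torus.geometry (Fin 3)) (hsDiameter σ N) p.2 p.1 ((j : ℝ) * (h / ((n : ℝ) + 1))) ≤
                lambertCount (Torus.geometry (Fin 3)) (hsDiameter σ N) p.2 p.1 (((j : ℝ) + 1) * (h / ((n : ℝ) + 1)))})
            Filter.atTop := by
  intro σ hσ hσ' N μ _ ha hb h hh
  have hG : (Torus.geometry (Fin 3)).IsHardSphereRegular (hsDiameter σ N) :=
    Torus.isHardSphereRegular_geometry ((hsDiameter_le hσ.le N).trans_lt hσ')
  have hGm : (Torus.geometry (Fin 3)).IsMeasurable := Torus.isMeasurable_geometry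
  -- measurability of the counts and of the increment events
  have hKm : ∀ s : ℝ, Measurable fun p : Config (N + 1) (Fin 3) T3 × (ℕ → V3) =>
      lambertCount (Torus.geometry (Fin 3)) (hsDiameter σ N) p.2 p.1 s :=
    fun s => measurable_lambertCount hG hGm s
  have hE : ∀ a b : ℝ, MeasurableSet {p : Config (N + 1) (Fin 3) T3 × (ℕ → V3) |
      1 + lambertCount (Torus.geometry (Fin 3)) (hsDiameter σ N) p.2 p.1 a ≤
        lambertCount (Torus.geometry (Fin 3)) (hsDiameter σ N) p.2 p.1 b} :=
    fun a b => measurableSet_le ((hKm a).const_add 1) (hKm b)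
  -- the number `S_n` of mesh intervals carrying an increment
  set S : ℕ → Config (N + 1) (Fin 3) T3 × (ℕ → V3) → ℝ≥0∞ := fun n p => ∑ j ∈ Finset.range (n + 1),
    {q : Config (N + 1) (Fin 3) T3 × (ℕ → V3) |
        1 + lambertCount (Torus.geometry (Fin 3)) (hsDiameter σ N) q.2 q.1 ((j : ℝ) * (h / ((n : ℝ) + 1))) ≤
          lambertCount (Torus.geometry (Fin 3)) (hsDiameter σ N) q.2 q.1
            (((j : ℝ) + 1) * (h / ((n : ℝ) + 1)))}.indicator 1 p with hS
  have hSm : ∀ n, Measurable (S n) := fun n =>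
    Finset.measurable_sum _ fun j _ => measurable_one.indicator (hE _ _)
  have hSi : ∀ n, ∫⁻ p, S n p ∂μ = ∑ j ∈ Finset.range (n + 1),
      μ {p | 1 + lambertCount (Torus.geometry (Fin 3)) (hsDiameter σ N) p.2 p.1 ((j : ℝ) * (h / ((n : ℝ) + 1))) ≤
        lambertCount (Torus.geometry (Fin 3)) (hsDiameter σ N) p.2 p.1 (((j : ℝ) + 1) * (h / ((n : ℝ) + 1)))} := by
    intro n
    rw [hS, lintegral_finsetSum _ fun j _ => measurable_one.indicator (hE _ _)]
    exact Finset.sum_congr rfl fun j _ => lintegral_indicator_one (hE _ _)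
  -- pathwise Korolyuk: `K_h ≤ liminf_n S_n` almost surely
  have hae : ∀ᵐ p ∂μ, (lambertCount (Torus.geometry (Fin 3)) (hsDiameter σ N) p.2 p.1 h : ℝ≥0∞) ≤
      liminf (fun n => S n p) atTop := by
    filter_upwards [ha, hb] with p hpa hpb
    refine le_liminf_of_le ?_ ?_
    · isBoundedDefault
    filter_upwards [eventually_lambertCount_le_sum hpa hpb hh] with n hn
    refine hn _ fun j hj => ?_
    rw [Set.indicator_of_mem (by exact hj), Pi.one_apply]
  -- Fatou
  calc ∫⁻ p, (lambertCount (Torus.geometry (Fin 3)) (hsDiameter σ N) p.2 p.1 h : ℝ≥0∞) ∂μ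
      ≤ ∫⁻ p, liminf (fun n => S n p) atTop ∂μ := lintegral_mono_ae hae
    _ ≤ liminf (fun n => ∫⁻ p, S n p ∂μ) atTop := lintegral_liminf_le hSm
    _ = _ := by simp_rw [hSi]

end Summit.AtomisticToContinuum.HydrodynamicLimit.Theorems.LambertianContactSwapLambertianEulerKorolyuk
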